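import Mathlib
import HarnessLib
import Summits.HubbardSuperconductivity.HubbardSuperconductivity.Theorems.KLProgrammeKLRegimeTwoVolumeTowerBaseDefs
import Summits.HubbardSuperconductivity.HubbardSuperconductivity.Theorems.KLProgrammeKLRegimeEngineScaleZeroE4PackageDoors
import Summits.HubbardSuperconductivity.HubbardSuperconductivity.Theorems.KLProgrammeH10TwoPointLimitIsoTorusSum
import Summits.HubbardSuperconductivity.HubbardSuperconductivity.Theorems.KLProgrammeKLRegimeTwoVolumeProfileBridge
import Literature.MathematicalPhysics.QuantumLattice.HubbardGridCharactersWeighted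
import Literature.MathematicalPhysics.QuantumLattice.HubbardTorusSingleScalePressure

/-!
# Route `KLProgramme` — crux K3, VL child `KLRegimeVolumeLimitV17F2` (stmt-HubbardSuperconductivity-20440), base of the two-volume tower:
# THE `(1 + Λ_T·|Δx⃗|)`-WEIGHTED ROWS AND COLUMNS OF THE ALIVE BLOCK `ε • E(F_0[K])·S_{4M}` (base atom (i), alive half; the inputs
# `hArow/hAcol` of `…TwoVolumeTowerBaseTransferData.towerBase_transferData_of_atoms`; cell gate-hubbard-kl, seat p3 g18; `--supports` 20440)

The base-transfer bundle `hdataT` of the VL interface of record (`…TwoVolumeTowerDataTSExists.exists_towerDataTS_of_readouts`) asks, for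
the alive block `ε • E(F_0[K])·S_N` of `klBaseTransfer V M β μ K` (`F_0[K] = klAnisoFamily V M β μ K klE0 0`, `S_N = hubbardGridSub V M β (4M)`,
`ε = β/2M`), that its rows and columns weighted by `1 + Λ_T·tnorm(x⃗_Y − x⃗_y)` be bounded by ONE constant, uniformly in the volume `V`,
the time cutoff `M` and the frame `K`.  Both kernels are translation invariant, so (Literature `HubbardGridCharactersWeighted`) the weighted row
is `ε` times ONE weighted product-torus `ℓ¹` norm of the character sum of the scale-`0` multiplier; the weight splits as
`1 + Λ_T·torusSiteDist(w, 0)`; the plain part is the engine's isotropic torus constant (`IsoTorusBoundAt klIsoT`, proved: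
`…H10TwoPointLimitIsoTorusSum.isoTorusBoundAt_klIsoT`; `klAnisoFamily … 0 = klIsoFamily … 0` definitionally) and the space part is the
(E4)₀ space moment under the doors (`spaceMoment_klAnisoFamily_zero_le_of_doors`: `≤ 8(klE4X0+1)·M/β = 4(klE4X0+1)/ε`):

* **`sum_norm_aliveBlock_mul_wt_row_le`** — under the scale-`0` engine binders (`P.WF`, `R.WF2`, `0 < c ≤ klEngC₃3 P R`, `c ≤ klE4C₃ R`,
  `μ ∈ klWindowC`, `0 < U ≤ klEngU₀3 P R c`, `U ≤ klE4U₀ R`, `klBetaMin ≤ β ≤ e^{c/U²}`, `FrameOK R U (nScales β) μ K`, `klEngL₃ β U ≤ V`,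
  `klEngM₃ β U V ≤ M`) and any rate `Λ_T ≥ 0`: every weighted row is `≤ klIsoT + 4·Λ_T·(klE4X0 + 1)`;
* **`sum_norm_aliveBlock_mul_wt_col_le`** — every weighted column is `≤ 2·(klIsoT + 4·Λ_T·(klE4X0 + 1))` (`sectorCount 0 = 2` sectors);
* **`aliveBlock_wtRows_klEng6`** — both, keyed by the registration thresholds `c ≤ klEngC₃6 P R`, `U ≤ klEngU₀6 P R c` (one `le_trans` per door),
  with the single constant `cgW := 2·(klIsoT + 4·Λ_T·(klE4X0 + 1)) ≥ 0` in the literal shape of `hArow/hAcol` (frame-wise: instantiate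
  `V := b·L`, `K := K_L`).

The SOURCE half of atom (i) (`hBrow/hBcol`, block `klSrcPlainBlock·S_N`) is NOT supplied here: its plain rows are
`1 + (1/2M)·Σ_{d odd ∈ ℤ/4M} 1/sin(πd/4M) ≍ (2/π)·ln M` (located defect «BASE-SRC-ROWS», KL STATUS 2026-08-28 14:2xZ), so no `M`-uniform
constant exists for it as typed.  Proofs only; no definition.  Honest framing: finite-torus bookkeeping of landed bounds; nothing here asserts
any stub of 20440, K3, VL or superconductivity.  [cite: BenfattoGiulianiMastropietro2006, §2.7 (2.70)–(2.71a), §3 (3.2)–(3.8)]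
-/

noncomputable section

namespace Summit.HubbardSuperconductivity.HubbardSuperconductivity.Theorems.TwoVolumeSource

set_option linter.dupNamespace false -- summit = problem name (single-conjunct summit), D-0017

open Finset Complex Literature.MathematicalPhysics.QuantumLattice GrassmannAlgebra Literature.Probability.LatticeModels
open Summit.HubbardSuperconductivity.HubbardSuperconductivity.Theorems.KLProgrammeLegKernels
open Summit.HubbardSuperconductivity.HubbardSuperconductivity.Theorems.KLRegimeSplit
open Summit.HubbardSuperconductivity.HubbardSuperconductivity.Theorems.EngineV8
open Summit.HubbardSuperconductivity.HubbardSuperconductivity.Theorems.ScaleZeroDecay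
open Summit.HubbardSuperconductivity.HubbardSuperconductivity.Theorems.TwoVolumeDefect
open scoped ComplexConjugate

variable {V M : ℕ} [NeZero V] [NeZero M]

/-! ## §1 The weighted multiplier torus sum with the spatial weight `1 + Λ_T·|w|` -/

/-- **The weighted product-torus `ℓ¹` norm of the scale-`0` multiplier with the weight `1 + Λ_T·tnorm(w)`** is at most
`(klIsoT + 4·Λ_T·(klE4X0+1))/ε`: plain part `IsoTorusBoundAt klIsoT` at `m = 0`, space part the (E4)₀ space moment under the doors.
[cite: BenfattoGiulianiMastropietro2006, §2.7 (2.71a) and §3 (3.2)–(3.8)] -/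
theorem wtTorusSum_klAnisoFamily_zero_le {P : SplitConsts} {R : RenConsts} {c μ U β : ℝ} {K : TrigPolyC4v}
    (hP : P.WF) (hR : R.WF2) (hc : 0 < c) (hc₃ : c ≤ klEngC₃3 P R) (hcD : c ≤ klE4C₃ R) (hμ : μ ∈ klWindowC) (hU : 0 < U)
    (hU₀ : U ≤ klEngU₀3 P R c) (hUD : U ≤ klE4U₀ R) (hβ : klBetaMin ≤ β) (hβc : β ≤ Real.exp (c / U ^ 2)) (hK : FrameOK R U (nScales β) μ K)
    (hL : klEngL₃ β U ≤ V) (hM : klEngM₃ β U V ≤ M) {ΛT : ℝ} (hΛT : 0 ≤ ΛT) (ω : Fin (sectorCount 0)) (c' : Fin 2) :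
    1 / (|β| * (V : ℝ) ^ 2) *
        ∑ dw : TorusSite 1 (2 * (2 * M)) × TorusSite 2 V, (1 + ΛT * (Torus.tnorm dw.2 : ℝ)) *
          ‖∑ k : FreqMomentum V M, klAnisoFamily V M β μ K klE0 0 ω k *
            (if c' = 0 then torusChar (fun _ : Fin 1 => ((k.1 : ℕ) : ZMod (2 * (2 * M)))) dw.1 * torusChar k.2 dw.2
              else conj (torusChar (fun _ : Fin 1 => ((k.1 : ℕ) : ZMod (2 * (2 * M)))) dw.1 * torusChar k.2 dw.2))‖ ≤
      (klIsoT + 4 * ΛT * (klE4X0 + 1)) / imagTimeWeight β M := by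
  have hRwf : R.WF := hR.wf
  have hU1 : |U| ≤ 1 := abs_le_one_of_le_klEngU₀3 hU hU₀
  have hκU : 16 / 15 * (R.Gfr 0 * |U|) ≤ 1 / 50 := gfr0_abs_mul_le_of_le_klEngU₀3 hU hU₀
  obtain ⟨hL15, -, -, -, hβ3M, -⟩ := scaleZero_regime_sizes hβ hL hM
  have hβ0 : 0 < β := beta_pos_of_klBetaMin_le hβ
  have hM0 : (0 : ℝ) < M := Nat.cast_pos.2 (Nat.pos_of_ne_zero (NeZero.ne M))
  set g : TorusSite 1 (2 * (2 * M)) × TorusSite 2 V → ℝ := fun dw =>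
    ‖∑ k : FreqMomentum V M, klAnisoFamily V M β μ K klE0 0 ω k *
      (if c' = 0 then torusChar (fun _ : Fin 1 => ((k.1 : ℕ) : ZMod (2 * (2 * M)))) dw.1 * torusChar k.2 dw.2
        else conj (torusChar (fun _ : Fin 1 => ((k.1 : ℕ) : ZMod (2 * (2 * M)))) dw.1 * torusChar k.2 dw.2))‖ with hg
  -- plain part: the isotropic torus bound at `m = 0` (`klAnisoFamily … 0 = klIsoFamily … 0`)
  have hplain : 1 / (|β| * (V : ℝ) ^ 2) * ∑ dw : TorusSite 1 (2 * (2 * M)) × TorusSite 2 V, g dw ≤ klIsoT / imagTimeWeight β M :=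
    TorusFourierL2.isoTorusBoundAt_klIsoT P R c hP hR hc hc₃ μ hμ U hU hU₀ β hβ hβc K hK V M hL hM 0 ω c'
  -- space part: the (E4)₀ space moment under the doors
  have hspace : 1 / (|β| * (V : ℝ) ^ 2) * ∑ dw : TorusSite 1 (2 * (2 * M)) × TorusSite 2 V, (torusSiteDist dw.2 0 : ℝ) * g dw ≤
      8 * (klE4X0 + 1) * (M / β) :=
    spaceMoment_klAnisoFamily_zero_le_of_doors hK hRwf hU hU1 hUD hc.le hcD hμ hκU hL15 hβ hβc hβ3M ω c'
  -- split the weight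
  have hsplit : ∑ dw : TorusSite 1 (2 * (2 * M)) × TorusSite 2 V, (1 + ΛT * (Torus.tnorm dw.2 : ℝ)) * g dw =
      ∑ dw : TorusSite 1 (2 * (2 * M)) × TorusSite 2 V, g dw +
        ΛT * ∑ dw : TorusSite 1 (2 * (2 * M)) × TorusSite 2 V, (torusSiteDist dw.2 0 : ℝ) * g dw := by
    rw [Finset.mul_sum, ← Finset.sum_add_distrib]
    refine Finset.sum_congr rfl fun dw _ => ?_
    have htn : (Torus.tnorm dw.2 : ℝ) = torusSiteDist dw.2 0 := by
      rw [← tnorm_sub_eq_torusSiteDist, sub_zero]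
    rw [htn]
    ring
  rw [hsplit, mul_add]
  have hcomm : 1 / (|β| * (V : ℝ) ^ 2) * (ΛT * ∑ dw : TorusSite 1 (2 * (2 * M)) × TorusSite 2 V, (torusSiteDist dw.2 0 : ℝ) * g dw) =
      ΛT * (1 / (|β| * (V : ℝ) ^ 2) * ∑ dw : TorusSite 1 (2 * (2 * M)) × TorusSite 2 V, (torusSiteDist dw.2 0 : ℝ) * g dw) := by
    ring
  rw [hcomm]
  have h2 : ΛT * (1 / (|β| * (V : ℝ) ^ 2) * ∑ dw : TorusSite 1 (2 * (2 * M)) × TorusSite 2 V, (torusSiteDist dw.2 0 : ℝ) * g dw) ≤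
      ΛT * (8 * (klE4X0 + 1) * (M / β)) := mul_le_mul_of_nonneg_left hspace hΛT
  have hid : klIsoT / imagTimeWeight β M + ΛT * (8 * (klE4X0 + 1) * (M / β)) = (klIsoT + 4 * ΛT * (klE4X0 + 1)) / imagTimeWeight β M := by
    rw [imagTimeWeight]
    field_simp
    ring
  calc _ ≤ klIsoT / imagTimeWeight β M + ΛT * (8 * (klE4X0 + 1) * (M / β)) := add_le_add hplain h2
    _ = (klIsoT + 4 * ΛT * (klE4X0 + 1)) / imagTimeWeight β M := hid

/-- `0 ≤ klIsoT + 4·Λ_T·(klE4X0 + 1)` for `Λ_T ≥ 0`. [folklore] -/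
theorem aliveBlock_cgW_nonneg {ΛT : ℝ} (hΛT : 0 ≤ ΛT) : 0 ≤ klIsoT + 4 * ΛT * (klE4X0 + 1) := by
  have h1 : 0 ≤ klIsoT := klIsoT_nonneg
  have h2 : 0 ≤ klE4X0 := uvSpaceMomentConst_nonneg _ _ _
  positivity

/-! ## §2 The weighted rows and columns of the alive block -/

/-- Entries of the alive block: `‖(ε • E·S) Y y‖ = ε·‖(E·S) Y y‖` (`ε = imagTimeWeight β M > 0`). [folklore] -/
theorem norm_aliveBlock_apply {β : ℝ} (hβ : 0 < β) (μ : ℝ) (K : TrigPolyC4v) (Y : SpaceTimeIdx V M × SectorLeg (sectorCount 0))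
    (y : GridLeg (GridPoint V (klGridN M))) :
    ‖((((imagTimeWeight β M : ℝ) : ℂ) • sectorAnalysisMatrix V M β (klAnisoFamily V M β μ K klE0 0)) * hubbardGridSub V M β (klGridN M)) Y y‖ =
      imagTimeWeight β M * ‖(sectorAnalysisMatrix V M β (klAnisoFamily V M β μ K klE0 0) * hubbardGridSub V M β (klGridN M)) Y y‖ := by
  have hε : 0 < imagTimeWeight β M := by
    have hM0 : (0 : ℝ) < M := Nat.cast_pos.2 (Nat.pos_of_ne_zero (NeZero.ne M))
    unfold imagTimeWeight
    positivity
  rw [Matrix.smul_mul, Matrix.smul_apply, norm_smul, Complex.norm_real, Real.norm_of_nonneg hε.le]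

omit [NeZero M] in
/-- The alive overlap kernel vanishes off the legs `((q, σ), c)` of the row's own spin and charge. [folklore] -/
theorem aliveOverlap_apply_eq_zero (β μ : ℝ) (K : TrigPolyC4v) (x : SpaceTimeIdx V M) (ω : Fin (sectorCount 0)) (σ c : Fin 2)
    (y : GridLeg (GridPoint V (klGridN M))) (h : y.1.2 ≠ σ ∨ y.2 ≠ c) :
    (sectorAnalysisMatrix V M β (klAnisoFamily V M β μ K klE0 0) * hubbardGridSub V M β (klGridN M)) (x, ((ω, σ), c)) y = 0 := by
  rw [sectorAnalysis_mul_hubbardGridSub_apply, if_neg]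
  rintro ⟨h2, h3⟩
  rcases h with h | h
  · exact h h2
  · exact h h3

/-- **BASE ATOM (i), ALIVE ROWS**: under the scale-`0` engine binders and the (E4)₀ doors, for every rate `Λ_T ≥ 0` and every row label `Y`,
`Σ_y ‖(ε • E(F_0[K])·S_{4M}) Y y‖·(1 + Λ_T·tnorm(x⃗_Y − x⃗_y)) ≤ klIsoT + 4·Λ_T·(klE4X0 + 1)` — uniformly in `V`, `M`, `K`.
[cite: BenfattoGiulianiMastropietro2006, §2.7 (2.71a) and §3 (3.2)–(3.8)] -/
theorem sum_norm_aliveBlock_mul_wt_row_le {P : SplitConsts} {R : RenConsts} {c μ U β : ℝ} {K : TrigPolyC4v}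
    (hP : P.WF) (hR : R.WF2) (hc : 0 < c) (hc₃ : c ≤ klEngC₃3 P R) (hcD : c ≤ klE4C₃ R) (hμ : μ ∈ klWindowC) (hU : 0 < U)
    (hU₀ : U ≤ klEngU₀3 P R c) (hUD : U ≤ klE4U₀ R) (hβ : klBetaMin ≤ β) (hβc : β ≤ Real.exp (c / U ^ 2)) (hK : FrameOK R U (nScales β) μ K)
    (hL : klEngL₃ β U ≤ V) (hM : klEngM₃ β U V ≤ M) {ΛT : ℝ} (hΛT : 0 ≤ ΛT) (Y : SpaceTimeIdx V M × SectorLeg (sectorCount 0)) :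
    ∑ y : GridLeg (GridPoint V (klGridN M)),
      ‖((((imagTimeWeight β M : ℝ) : ℂ) • sectorAnalysisMatrix V M β (klAnisoFamily V M β μ K klE0 0)) * hubbardGridSub V M β (klGridN M)) Y y‖ *
        (1 + ΛT * (Torus.tnorm (Y.1.2 - y.1.1.2) : ℝ)) ≤ klIsoT + 4 * ΛT * (klE4X0 + 1) := by
  have hβ0 : 0 < β := beta_pos_of_klBetaMin_le hβ
  have hM0 : (0 : ℝ) < M := Nat.cast_pos.2 (Nat.pos_of_ne_zero (NeZero.ne M))
  have hε : 0 < imagTimeWeight β M := by unfold imagTimeWeight; positivity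
  obtain ⟨x, ⟨⟨ω, σ⟩, c'⟩⟩ := Y
  -- pull `ε` out
  have hsum : ∑ y : GridLeg (GridPoint V (klGridN M)),
      ‖((((imagTimeWeight β M : ℝ) : ℂ) • sectorAnalysisMatrix V M β (klAnisoFamily V M β μ K klE0 0)) * hubbardGridSub V M β (klGridN M))
          (x, ((ω, σ), c')) y‖ * (1 + ΛT * (Torus.tnorm (x.2 - y.1.1.2) : ℝ)) =
      imagTimeWeight β M * ∑ y : GridLeg (GridPoint V (klGridN M)),
        ‖(sectorAnalysisMatrix V M β (klAnisoFamily V M β μ K klE0 0) * hubbardGridSub V M β (klGridN M)) (x, ((ω, σ), c')) y‖ *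
          (1 + ΛT * (Torus.tnorm (x.2 - y.1.1.2) : ℝ)) := by
    rw [Finset.mul_sum]
    exact Finset.sum_congr rfl fun y _ => by rw [norm_aliveBlock_apply hβ0, mul_assoc]
  rw [hsum]
  -- the weight as a function on the product torus at the difference point
  set ψ : TorusSite 1 (2 * (2 * M)) → TorusSite 2 V → ℝ := fun _ w => 1 + ΛT * (Torus.tnorm w : ℝ) with hψ
  have hred : ∑ y : GridLeg (GridPoint V (klGridN M)),
      ‖(sectorAnalysisMatrix V M β (klAnisoFamily V M β μ K klE0 0) * hubbardGridSub V M β (klGridN M)) (x, ((ω, σ), c')) y‖ *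
        (1 + ΛT * (Torus.tnorm (x.2 - y.1.1.2) : ℝ)) =
      ∑ q : GridPoint V (2 * (2 * M)),
        ‖(sectorAnalysisMatrix V M β (klAnisoFamily V M β μ K klE0 0) * hubbardGridSub V M β (2 * (2 * M))) (x, ((ω, σ), c')) ((q, σ), c')‖ *
          ψ (fun _ : Fin 1 => ((q.1 : ℕ) : ZMod (2 * (2 * M))) - 2 * ((x.1 : ℕ) : ZMod (2 * (2 * M)))) (q.2 - x.2) := by
    rw [Fintype.sum_prod_type, Fintype.sum_prod_type]
    refine Finset.sum_congr rfl fun q _ => ?_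
    rw [Fintype.sum_eq_single σ fun σ' hσ' => ?_, Fintype.sum_eq_single c' fun c'' hc'' => ?_]
    · simp only [hψ]
      rw [← Torus.tnorm_neg, neg_sub]
    · rw [aliveOverlap_apply_eq_zero β μ K x ω σ c' ((q, σ), c'') (Or.inr hc''), norm_zero, zero_mul]
    · exact Finset.sum_eq_zero fun c'' _ => by
        rw [aliveOverlap_apply_eq_zero β μ K x ω σ c' ((q, σ'), c'') (Or.inl hσ'), norm_zero, zero_mul]
  rw [hred]
  have hT := fun ω' c'' => wtTorusSum_klAnisoFamily_zero_le hP hR hc hc₃ hcD hμ hU hU₀ hUD hβ hβc hK hL hM hΛT ω' c''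
  have h := rowSum_mul_sectorAnalysis_mul_hubbardGridSub_le_of_weight hβ0.ne' (klAnisoFamily V M β μ K klE0 0) ψ hT ω σ c' x
  calc imagTimeWeight β M * _ ≤ imagTimeWeight β M * ((klIsoT + 4 * ΛT * (klE4X0 + 1)) / imagTimeWeight β M) :=
        mul_le_mul_of_nonneg_left h hε.le
    _ = klIsoT + 4 * ΛT * (klE4X0 + 1) := by field_simp

/-- **BASE ATOM (i), ALIVE COLUMNS**: under the same binders, for every rate `Λ_T ≥ 0` and every grid leg `y`,
`Σ_Y ‖(ε • E(F_0[K])·S_{4M}) Y y‖·(1 + Λ_T·tnorm(x⃗_Y − x⃗_y)) ≤ 2·(klIsoT + 4·Λ_T·(klE4X0 + 1))` (`sectorCount 0 = 2` sectors).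
[cite: BenfattoGiulianiMastropietro2006, §2.7 (2.71a) and §3 (3.2)–(3.8)] -/
theorem sum_norm_aliveBlock_mul_wt_col_le {P : SplitConsts} {R : RenConsts} {c μ U β : ℝ} {K : TrigPolyC4v}
    (hP : P.WF) (hR : R.WF2) (hc : 0 < c) (hc₃ : c ≤ klEngC₃3 P R) (hcD : c ≤ klE4C₃ R) (hμ : μ ∈ klWindowC) (hU : 0 < U)
    (hU₀ : U ≤ klEngU₀3 P R c) (hUD : U ≤ klE4U₀ R) (hβ : klBetaMin ≤ β) (hβc : β ≤ Real.exp (c / U ^ 2)) (hK : FrameOK R U (nScales β) μ K)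
    (hL : klEngL₃ β U ≤ V) (hM : klEngM₃ β U V ≤ M) {ΛT : ℝ} (hΛT : 0 ≤ ΛT) (y : GridLeg (GridPoint V (klGridN M))) :
    ∑ Y : SpaceTimeIdx V M × SectorLeg (sectorCount 0),
      ‖((((imagTimeWeight β M : ℝ) : ℂ) • sectorAnalysisMatrix V M β (klAnisoFamily V M β μ K klE0 0)) * hubbardGridSub V M β (klGridN M)) Y y‖ *
        (1 + ΛT * (Torus.tnorm (Y.1.2 - y.1.1.2) : ℝ)) ≤ 2 * (klIsoT + 4 * ΛT * (klE4X0 + 1)) := by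
  classical
  have hβ0 : 0 < β := beta_pos_of_klBetaMin_le hβ
  have hM0 : (0 : ℝ) < M := Nat.cast_pos.2 (Nat.pos_of_ne_zero (NeZero.ne M))
  have hε : 0 < imagTimeWeight β M := by unfold imagTimeWeight; positivity
  obtain ⟨⟨q, σ⟩, c'⟩ := y
  -- pull `ε` out
  have hsum : ∑ Y : SpaceTimeIdx V M × SectorLeg (sectorCount 0),
      ‖((((imagTimeWeight β M : ℝ) : ℂ) • sectorAnalysisMatrix V M β (klAnisoFamily V M β μ K klE0 0)) * hubbardGridSub V M β (klGridN M))
          Y ((q, σ), c')‖ * (1 + ΛT * (Torus.tnorm (Y.1.2 - q.2) : ℝ)) =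
      imagTimeWeight β M * ∑ Y : SpaceTimeIdx V M × SectorLeg (sectorCount 0),
        ‖(sectorAnalysisMatrix V M β (klAnisoFamily V M β μ K klE0 0) * hubbardGridSub V M β (klGridN M)) Y ((q, σ), c')‖ *
          (1 + ΛT * (Torus.tnorm (Y.1.2 - q.2) : ℝ)) := by
    rw [Finset.mul_sum]
    exact Finset.sum_congr rfl fun Y _ => by rw [norm_aliveBlock_apply hβ0, mul_assoc]
  rw [hsum]
  set ψ : TorusSite 1 (2 * (2 * M)) → TorusSite 2 V → ℝ := fun _ w => 1 + ΛT * (Torus.tnorm w : ℝ) with hψ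
  have hψ0 : ∀ d w, 0 ≤ ψ d w := fun d w => by simp only [hψ]; positivity
  have hred : ∑ Y : SpaceTimeIdx V M × SectorLeg (sectorCount 0),
      ‖(sectorAnalysisMatrix V M β (klAnisoFamily V M β μ K klE0 0) * hubbardGridSub V M β (klGridN M)) Y ((q, σ), c')‖ *
        (1 + ΛT * (Torus.tnorm (Y.1.2 - q.2) : ℝ)) =
      ∑ ω : Fin (sectorCount 0), ∑ x : SpaceTimeIdx V M,
        ‖(sectorAnalysisMatrix V M β (klAnisoFamily V M β μ K klE0 0) * hubbardGridSub V M β (2 * (2 * M))) (x, ((ω, σ), c')) ((q, σ), c')‖ *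
          ψ (fun _ : Fin 1 => ((q.1 : ℕ) : ZMod (2 * (2 * M))) - 2 * ((x.1 : ℕ) : ZMod (2 * (2 * M)))) (q.2 - x.2) := by
    rw [Fintype.sum_prod_type, Finset.sum_comm, Fintype.sum_prod_type, Fintype.sum_prod_type]
    refine Finset.sum_congr rfl fun ω _ => ?_
    rw [Fintype.sum_eq_single σ fun σ' hσ' => ?_]
    · rw [Fintype.sum_eq_single c' fun c'' hc'' => ?_]
      · refine Finset.sum_congr rfl fun x _ => ?_
        simp only [hψ]
        rw [← Torus.tnorm_neg, neg_sub]
      · exact Finset.sum_eq_zero fun x _ => by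
          rw [aliveOverlap_apply_eq_zero β μ K x ω σ c'' ((q, σ), c') (Or.inr (Ne.symm hc'')), norm_zero, zero_mul]
    · exact Finset.sum_eq_zero fun c'' _ => Finset.sum_eq_zero fun x _ => by
        rw [aliveOverlap_apply_eq_zero β μ K x ω σ' c'' ((q, σ), c') (Or.inl (Ne.symm hσ')), norm_zero, zero_mul]
  rw [hred]
  have hT := fun ω' c'' => wtTorusSum_klAnisoFamily_zero_le hP hR hc hc₃ hcD hμ hU hU₀ hUD hβ hβc hK hL hM hΛT ω' c''
  have h := colSum_mul_sectorAnalysis_mul_hubbardGridSub_le_of_weight hβ0.ne' (klAnisoFamily V M β μ K klE0 0) ψ hψ0 hT σ c' q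
  have h2 : ((sectorCount 0 : ℕ) : ℝ) = 2 := by simp [sectorCount]
  calc imagTimeWeight β M * _
        ≤ imagTimeWeight β M * (((sectorCount 0 : ℕ) : ℝ) * ((klIsoT + 4 * ΛT * (klE4X0 + 1)) / imagTimeWeight β M)) :=
        mul_le_mul_of_nonneg_left h hε.le
    _ = 2 * (klIsoT + 4 * ΛT * (klE4X0 + 1)) := by rw [h2]; field_simp

/-! ## §3 Keyed by the registration thresholds `klEngC₃6`, `klEngU₀6` -/

/-- **BASE ATOM (i), ALIVE HALF, AT THE REGISTRATION THRESHOLDS** (`c ≤ klEngC₃6 P R`, `U ≤ klEngU₀6 P R c`; one `le_trans` per door):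
with `cgW := 2·(klIsoT + 4·Λ_T·(klE4X0 + 1)) ≥ 0`, the weighted rows AND columns of the alive block are `≤ cgW` — the literal shape of the
hypotheses `hArow/hAcol` of `towerBase_transferData_of_atoms` (instantiate `V := b·L`, `K := klFlowFrameU L M β U μ (nScales β + 1)`).
[cite: BenfattoGiulianiMastropietro2006, §2.7 (2.70)–(2.71a)] -/
theorem aliveBlock_wtRows_klEng6 {P : SplitConsts} {R : RenConsts} {c μ U β : ℝ} {K : TrigPolyC4v}
    (hP : P.WF) (hR : R.WF2) (hc : 0 < c) (hc6 : c ≤ klEngC₃6 P R) (hμ : μ ∈ klWindowC) (hU : 0 < U) (hU6 : U ≤ klEngU₀6 P R c)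
    (hβ : klBetaMin ≤ β) (hβc : β ≤ Real.exp (c / U ^ 2)) (hK : FrameOK R U (nScales β) μ K) (hL : klEngL₃ β U ≤ V) (hM : klEngM₃ β U V ≤ M)
    {ΛT : ℝ} (hΛT : 0 ≤ ΛT) :
    0 ≤ 2 * (klIsoT + 4 * ΛT * (klE4X0 + 1)) ∧
    (∀ Y : SpaceTimeIdx V M × SectorLeg (sectorCount 0), ∑ y : GridLeg (GridPoint V (klGridN M)),
      ‖((((imagTimeWeight β M : ℝ) : ℂ) • sectorAnalysisMatrix V M β (klAnisoFamily V M β μ K klE0 0)) * hubbardGridSub V M β (klGridN M)) Y y‖ *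
        (1 + ΛT * (Torus.tnorm (Y.1.2 - y.1.1.2) : ℝ)) ≤ 2 * (klIsoT + 4 * ΛT * (klE4X0 + 1))) ∧
    (∀ y : GridLeg (GridPoint V (klGridN M)), ∑ Y : SpaceTimeIdx V M × SectorLeg (sectorCount 0),
      ‖((((imagTimeWeight β M : ℝ) : ℂ) • sectorAnalysisMatrix V M β (klAnisoFamily V M β μ K klE0 0)) * hubbardGridSub V M β (klGridN M)) Y y‖ *
        (1 + ΛT * (Torus.tnorm (Y.1.2 - y.1.1.2) : ℝ)) ≤ 2 * (klIsoT + 4 * ΛT * (klE4X0 + 1))) := by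
  have hc₃ : c ≤ klEngC₃3 P R := hc6.trans (klEngC₃6_le_klEngC₃3 P R)
  have hcD : c ≤ klE4C₃ R := hc6.trans (klEngC₃6_le_klE4C₃ P R)
  have hU₀ : U ≤ klEngU₀3 P R c := hU6.trans (klEngU₀6_le_klEngU₀3 P R c)
  have hUD : U ≤ klE4U₀ R := hU6.trans (klEngU₀6_le_klE4U₀ P R c)
  have h0 := aliveBlock_cgW_nonneg hΛT
  refine ⟨by positivity, fun Y => ?_, fun y => ?_⟩
  · exact (sum_norm_aliveBlock_mul_wt_row_le hP hR hc hc₃ hcD hμ hU hU₀ hUD hβ hβc hK hL hM hΛT Y).trans (by linarith)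
  · exact sum_norm_aliveBlock_mul_wt_col_le hP hR hc hc₃ hcD hμ hU hU₀ hUD hβ hβc hK hL hM hΛT y

end Summit.HubbardSuperconductivity.HubbardSuperconductivity.Theorems.TwoVolumeSource

end
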